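import Mathlib
import Literature.Analysis.FunctionSpaces.TorusTrigPoly
import Literature.Analysis.FunctionSpaces.TorusDirichletKernel
import Summits.AnomalousDissipation.AnomalousDissipation.Theorems.TaylorCertificatesPacketLemmaStrain
import Summits.AnomalousDissipation.AnomalousDissipation.Theorems.TaylorCertificatesPacketLemmaPacket
import HarnessLib

/-!
# Route TaylorCertificates — `PacketLemma`, helper 9: the carrier of the packet

Finite-dimensional preliminaries for the proof of
`Summit.AnomalousDissipation.AnomalousDissipation.Theses.TaylorCertificates.PacketLemma`
(item stmt-AnomalousDissipation-14032):

* `abs_inner_sub_inner_le` — `|⟪x,Ax⟫ - ⟪y,Ay⟫| ≤ s‖x+y‖‖x-y‖` for a linear map whose quadratic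
  form is bounded by `s` on the unit sphere;
* `exists_unit_perp`, `exists_latticeVec_near` — a unit vector orthogonal to a given unit vector of
  `ℝ³`, and rounding to the lattice `ℤ³` within distance `1`;
* `carrier_frame` — for a unit `ξ` and `q` with `‖q‖ ≥ 2`, `|⟪q,ξ⟫| ≤ 1`: the frame
  `a = (ξ × q)/‖ξ × q‖`, `P = q × a` has `‖a‖ = 1`, `‖P‖ = ‖q‖` and
  `‖P̂ + ξ‖ ‖P̂ - ξ‖ ≤ 2/‖q‖` (vector triple product);
* `carrier_frequencies` — with `M + 1 = 2¹⁰ D` and `2²² D - 1 ≤ |p| ≤ 2²² D + 1`, the frequencies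
  `Ω_M + p` lie in the shell `2D < |m| ≤ 2²³ D`, some `|2pᵢ| > 2M + D`, and `0 ∉ Ω_M + p`;
* `div_le_of_packet_bounds` — the ratio bookkeeping `F/N ≤ g + s(μ + κ + 2δ(1+κ))`.

No definitions, no named facts.
-/

noncomputable section

open MeasureTheory UnitAddTorus Complex Real
open scoped ComplexConjugate Pointwise

namespace Summit.AnomalousDissipation.AnomalousDissipation.Theorems

-- the mandated namespace `Summit.<Summit>.<Problem>.Theorems` repeats `AnomalousDissipation` (single-problem summit)
set_option linter.dupNamespace false

open Literature.Analysis.FunctionSpaces Literature.Analysis.FunctionSpaces.Torus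

/-! ### Finite-dimensional preliminaries -/

/-- **Difference of quadratic forms**: `|⟪x,Ax⟫ - ⟪y,Ay⟫| ≤ s ‖x+y‖ ‖x-y‖` when the quadratic
form of `A` is bounded by `s` on the unit sphere. [folklore] -/
theorem abs_inner_sub_inner_le {E : Type*} [NormedAddCommGroup E] [InnerProductSpace ℝ E]
    (A : E →L[ℝ] E) {s : ℝ} (hA : ∀ η : E, ‖η‖ = 1 → |inner ℝ η (A η)| ≤ s) (x y : E) :
    |inner ℝ x (A x) - inner ℝ y (A y)| ≤ s * ‖x + y‖ * ‖x - y‖ := by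
  have hid : inner ℝ x (A x) - inner ℝ y (A y) =
      2⁻¹ * (inner ℝ (x + y) (A (x - y)) + inner ℝ (x - y) (A (x + y))) := by
    simp only [map_add, map_sub, inner_add_left, inner_add_right, inner_sub_left, inner_sub_right]
    ring
  rw [hid, abs_mul, abs_of_pos (by norm_num : (0 : ℝ) < 2⁻¹)]
  have h := abs_inner_add_inner_le A hA (x + y) (x - y)
  linarith

/-- Every unit vector of `ℝ³` has a unit vector orthogonal to it. [folklore] -/
theorem exists_unit_perp (ξ : EuclideanSpace ℝ (Fin 3)) (hξ : ‖ξ‖ = 1) :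
    ∃ u : EuclideanSpace ℝ (Fin 3), ‖u‖ = 1 ∧ inner ℝ u ξ = 0 := by
  have hξ2 : ξ 0 ^ 2 + ξ 1 ^ 2 + ξ 2 ^ 2 = 1 := by
    have h := EuclideanSpace.norm_sq_eq ξ
    rw [hξ, Fin.sum_univ_three] at h
    simp only [Real.norm_eq_abs, sq_abs, one_pow] at h
    linarith
  -- two candidates; one of them has norm² ≥ 1/2
  set v₁ : EuclideanSpace ℝ (Fin 3) := WithLp.toLp 2 ![0, ξ 2, -ξ 1] with hv₁
  set v₂ : EuclideanSpace ℝ (Fin 3) := WithLp.toLp 2 ![ξ 1, -ξ 0, 0] with hv₂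
  have hperp₁ : inner ℝ v₁ ξ = 0 := by
    rw [EuclideanSpace.inner_eq_star_dotProduct, hv₁]
    simp [dotProduct, Fin.sum_univ_three]; ring
  have hperp₂ : inner ℝ v₂ ξ = 0 := by
    rw [EuclideanSpace.inner_eq_star_dotProduct, hv₂]
    simp [dotProduct, Fin.sum_univ_three]; ring
  have hn₁ : ‖v₁‖ ^ 2 = ξ 2 ^ 2 + ξ 1 ^ 2 := by
    rw [EuclideanSpace.norm_sq_eq, Fin.sum_univ_three, hv₁]
    simp [Real.norm_eq_abs, sq_abs]
  have hn₂ : ‖v₂‖ ^ 2 = ξ 1 ^ 2 + ξ 0 ^ 2 := by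
    rw [EuclideanSpace.norm_sq_eq, Fin.sum_univ_three, hv₂]
    simp [Real.norm_eq_abs, sq_abs]
  have key : ∀ v : EuclideanSpace ℝ (Fin 3), inner ℝ v ξ = 0 → 2⁻¹ ≤ ‖v‖ ^ 2 →
      ∃ u : EuclideanSpace ℝ (Fin 3), ‖u‖ = 1 ∧ inner ℝ u ξ = 0 := by
    intro v hv hv2
    have hv0 : ‖v‖ ≠ 0 := fun h => by rw [h] at hv2; norm_num at hv2
    refine ⟨‖v‖⁻¹ • v, ?_, ?_⟩
    · rw [norm_smul, norm_inv, norm_norm, inv_mul_cancel₀ hv0]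
    · rw [inner_smul_left, hv, mul_zero]
  by_cases h : 2⁻¹ ≤ ‖v₁‖ ^ 2
  · exact key v₁ hperp₁ h
  · refine key v₂ hperp₂ ?_
    have h' := lt_of_not_ge h
    rw [hn₁] at h'
    rw [hn₂]
    nlinarith [sq_nonneg (ξ 1)]

/-- Rounding: every point of `ℝ³` is within distance `1` of a lattice vector. [folklore] -/
theorem exists_latticeVec_near (y : EuclideanSpace ℝ (Fin 3)) :
    ∃ p : Fin 3 → ℤ, ‖latticeVec p - y‖ ≤ 1 := by
  refine ⟨fun i => round (y i), ?_⟩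
  have h : ‖latticeVec (fun i => round (y i)) - y‖ ^ 2 ≤ 1 := by
    rw [EuclideanSpace.norm_sq_eq, Fin.sum_univ_three]
    simp only [WithLp.ofLp_sub, Pi.sub_apply, latticeVec_apply, Real.norm_eq_abs, sq_abs]
    have hb : ∀ i, ((round (y i) : ℤ) - y i) ^ 2 ≤ 4⁻¹ := fun i => by
      have h1 := abs_sub_round (y i)
      rw [abs_sub_comm] at h1
      have h2 : ((round (y i) : ℤ) - y i) ^ 2 = |↑(round (y i)) - y i| ^ 2 := (sq_abs _).symm
      rw [h2]
      nlinarith [abs_nonneg ((round (y i) : ℝ) - y i)]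
    linarith [hb 0, hb 1, hb 2]
  exact (pow_le_one_iff_of_nonneg (norm_nonneg _) two_ne_zero).1 h

/-- `|k|² = ‖latticeVec k‖²`. [folklore] -/
theorem freqNormSq_eq_norm_sq (k : Fin 3 → ℤ) : freqNormSq k = ‖latticeVec k‖ ^ 2 := by
  rw [EuclideanSpace.norm_sq_eq, freqNormSq]
  simp [latticeVec_apply, Real.norm_eq_abs, sq_abs]

/-- `π² ≤ 10`. [folklore] -/
theorem pi_sq_le_ten : π ^ 2 ≤ 10 := by
  have h := Real.pi_lt_d2
  nlinarith [Real.pi_pos]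

/-- **Ratio bookkeeping**: if `F ≤ X (ĝ + s κ)`, `X(1-δ) ≤ N ≤ X(1+δ)`, `|ĝ| ≤ s`, `ĝ ≤ g + s μ`
with `X > 0`, `0 ≤ δ ≤ 1/2`, then `F/N ≤ g + s (μ + κ + 2δ(1+κ))`. [folklore] -/
theorem div_le_of_packet_bounds {F X N ĝ g s κ δ μ : ℝ} (hX : 0 < X) (hs : 0 ≤ s) (hκ : 0 ≤ κ)
    (hδ0 : 0 ≤ δ) (hδ : δ ≤ 2⁻¹) (hF : F ≤ X * (ĝ + s * κ)) (hNlo : X * (1 - δ) ≤ N)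
    (hNhi : N ≤ X * (1 + δ)) (hĝ : |ĝ| ≤ s) (hĝg : ĝ ≤ g + s * μ) :
    F / N ≤ g + s * (μ + κ + 2 * δ * (1 + κ)) := by
  have hN : 0 < N := lt_of_lt_of_le (by nlinarith) hNlo
  have hT : |ĝ + s * κ| ≤ s + s * κ := (abs_add_le _ _).trans (by
    rw [abs_of_nonneg (mul_nonneg hs hκ)]; linarith)
  rw [div_le_iff₀ hN]
  rcases le_or_gt 0 (ĝ + s * κ) with hT0 | hT0
  · -- nonnegative numerator: use the lower bound for `N`
    have hd : 0 < 1 - δ := by linarith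
    have h1 : F ≤ (ĝ + s * κ) / (1 - δ) * N := by
      calc F ≤ X * (ĝ + s * κ) := hF
        _ = (ĝ + s * κ) / (1 - δ) * (X * (1 - δ)) := by field_simp
        _ ≤ (ĝ + s * κ) / (1 - δ) * N :=
            mul_le_mul_of_nonneg_left hNlo (div_nonneg hT0 hd.le)
    have hinv : 1 / (1 - δ) ≤ 1 + 2 * δ := by
      rw [div_le_iff₀ hd]
      nlinarith
    have h2 : (ĝ + s * κ) / (1 - δ) ≤ (ĝ + s * κ) * (1 + 2 * δ) := by
      rw [div_eq_mul_one_div]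
      exact mul_le_mul_of_nonneg_left hinv hT0
    have hTle : ĝ + s * κ ≤ s + s * κ := (le_abs_self _).trans hT
    have h3 : (ĝ + s * κ) * (1 + 2 * δ) ≤ g + s * (μ + κ + 2 * δ * (1 + κ)) := by
      have := mul_le_mul_of_nonneg_left hTle (by positivity : 0 ≤ 2 * δ)
      nlinarith
    calc F ≤ (ĝ + s * κ) / (1 - δ) * N := h1
      _ ≤ (g + s * (μ + κ + 2 * δ * (1 + κ))) * N :=
          mul_le_mul_of_nonneg_right (h2.trans h3) hN.le
  · -- negative numerator: use the upper bound for `N`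
    have hd : 0 < 1 + δ := by linarith
    have h1 : F ≤ (ĝ + s * κ) / (1 + δ) * N := by
      calc F ≤ X * (ĝ + s * κ) := hF
        _ = (ĝ + s * κ) / (1 + δ) * (X * (1 + δ)) := by field_simp
        _ ≤ (ĝ + s * κ) / (1 + δ) * N :=
            mul_le_mul_of_nonpos_left hNhi (div_nonpos_of_nonpos_of_nonneg hT0.le hd.le)
    -- `T/(1+δ) = T + δ(-T)/(1+δ) ≤ T + δ (s + sκ)`
    have hnegT : -(ĝ + s * κ) ≤ s + s * κ := (neg_le_abs _).trans hT
    have h2 : (ĝ + s * κ) / (1 + δ) ≤ (ĝ + s * κ) + δ * (s + s * κ) := by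
      have hsplit : (ĝ + s * κ) / (1 + δ) = (ĝ + s * κ) + δ * (-(ĝ + s * κ)) / (1 + δ) := by
        field_simp; ring
      rw [hsplit]
      have h3 : δ * (-(ĝ + s * κ)) / (1 + δ) ≤ δ * (-(ĝ + s * κ)) :=
        div_le_self (mul_nonneg hδ0 (by linarith)) (by linarith)
      have h4 : δ * (-(ĝ + s * κ)) ≤ δ * (s + s * κ) := mul_le_mul_of_nonneg_left hnegT hδ0
      linarith
    have h3 : (ĝ + s * κ) + δ * (s + s * κ) ≤ g + s * (μ + κ + 2 * δ * (1 + κ)) := by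
      nlinarith [mul_nonneg hδ0 (mul_nonneg hs hκ), mul_nonneg hδ0 hs]
    calc F ≤ (ĝ + s * κ) / (1 + δ) * N := h1
      _ ≤ (g + s * (μ + κ + 2 * δ * (1 + κ))) * N := mul_le_mul_of_nonneg_right (h2.trans h3) hN.le

/-- **Geometry of the carrier frame.** For a unit `ξ` and `q` with `‖q‖ ≥ 2`, `|⟪q, ξ⟫| ≤ 1`, the
unit vector `a = (ξ × q)/‖ξ × q‖` is orthogonal to `q`, `P = q × a` has `‖P‖ = ‖q‖`, and its
direction `P̂` satisfies `‖P̂ + ξ‖ ‖P̂ - ξ‖ ≤ 2/‖q‖`. [folklore] -/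
theorem carrier_frame (ξ q : EuclideanSpace ℝ (Fin 3)) (hξ : ‖ξ‖ = 1) (hq : 2 ≤ ‖q‖)
    (ht : |inner ℝ q ξ| ≤ 1) :
    ∃ a P : EuclideanSpace ℝ (Fin 3),
      P = WithLp.toLp 2 (crossProduct (WithLp.ofLp q) (WithLp.ofLp a)) ∧ ‖a‖ = 1 ∧ ‖P‖ = ‖q‖ ∧
      ‖‖P‖⁻¹ • P + ξ‖ * ‖‖P‖⁻¹ • P - ξ‖ ≤ 2 / ‖q‖ := by
  obtain ⟨c, hc⟩ : ∃ c : EuclideanSpace ℝ (Fin 3),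
      c = WithLp.toLp 2 (crossProduct (WithLp.ofLp ξ) (WithLp.ofLp q)) := ⟨_, rfl⟩
  have hq0 : 0 < ‖q‖ := by linarith
  have htq : inner ℝ ξ q = inner ℝ q ξ := real_inner_comm _ _
  have hc2 : ‖c‖ ^ 2 = ‖q‖ ^ 2 - inner ℝ q ξ ^ 2 := by
    rw [hc, norm_crossE_sq, hξ, htq]; ring
  have ht2 : inner ℝ q ξ ^ 2 ≤ 1 := by
    have := abs_le.1 ht; nlinarith
  have hc2pos : 0 < ‖c‖ ^ 2 := by rw [hc2]; nlinarith
  have hcne : ‖c‖ ≠ 0 := fun h => by rw [h] at hc2pos; norm_num at hc2pos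
  have hcpos : 0 < ‖c‖ := lt_of_le_of_ne (norm_nonneg _) (Ne.symm hcne)
  -- the frame
  refine ⟨‖c‖⁻¹ • c, WithLp.toLp 2 (crossProduct (WithLp.ofLp q) (WithLp.ofLp (‖c‖⁻¹ • c))), rfl, ?_, ?_⟩
  · rw [norm_smul, norm_inv, norm_norm, inv_mul_cancel₀ hcne]
  -- `P = ‖c‖⁻¹ (‖q‖² ξ - ⟪q,ξ⟫ q)`
  have hPeq : (WithLp.toLp 2 (crossProduct (WithLp.ofLp q) (WithLp.ofLp (‖c‖⁻¹ • c))) :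
      EuclideanSpace ℝ (Fin 3)) = ‖c‖⁻¹ • (‖q‖ ^ 2 • ξ - inner ℝ q ξ • q) := by
    rw [WithLp.ofLp_smul, LinearMap.map_smul, WithLp.toLp_smul, hc, WithLp.ofLp_toLp,
      cross_cross_eq_smul_sub_smul', WithLp.toLp_sub, WithLp.toLp_smul, WithLp.toLp_smul,
      WithLp.toLp_ofLp, WithLp.toLp_ofLp, ← real_inner_self_eq_norm_sq,
      EuclideanSpace.inner_eq_star_dotProduct, EuclideanSpace.inner_eq_star_dotProduct]
    simp only [star_trivial]
  have hqa : inner ℝ q (‖c‖⁻¹ • c) = 0 := by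
    rw [inner_smul_right, hc, inner_crossE_self, mul_zero]
  have hPn : ‖(WithLp.toLp 2 (crossProduct (WithLp.ofLp q) (WithLp.ofLp (‖c‖⁻¹ • c))) :
      EuclideanSpace ℝ (Fin 3))‖ = ‖q‖ := by
    have h := norm_crossE_sq q (‖c‖⁻¹ • c)
    rw [hqa, show ‖(‖c‖⁻¹ • c : EuclideanSpace ℝ (Fin 3))‖ = 1 by
      rw [norm_smul, norm_inv, norm_norm, inv_mul_cancel₀ hcne]] at h
    have h' : ‖(WithLp.toLp 2 (crossProduct (WithLp.ofLp q) (WithLp.ofLp (‖c‖⁻¹ • c))) :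
        EuclideanSpace ℝ (Fin 3))‖ ^ 2 = ‖q‖ ^ 2 := by rw [h]; ring
    exact (pow_left_inj₀ (norm_nonneg _) (norm_nonneg _) two_ne_zero).1 h'
  refine ⟨hPn, ?_⟩
  rw [hPn, hPeq]
  -- the direction `P̂` and its inner product `ρ` with `ξ`
  have hρ : inner ℝ (‖q‖⁻¹ • (‖c‖⁻¹ • (‖q‖ ^ 2 • ξ - inner ℝ q ξ • q))) ξ = ‖c‖ / ‖q‖ := by
    rw [inner_smul_left, inner_smul_left, inner_sub_left, inner_smul_left, inner_smul_left,
      real_inner_self_eq_norm_sq, hξ]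
    simp only [conj_trivial]
    have : ‖q‖ ^ 2 * 1 ^ 2 - inner ℝ q ξ * inner ℝ q ξ = ‖c‖ ^ 2 := by rw [hc2]; ring
    rw [this]
    field_simp
  have hunit : ‖(‖q‖⁻¹ • (‖c‖⁻¹ • (‖q‖ ^ 2 • ξ - inner ℝ q ξ • q)) : EuclideanSpace ℝ (Fin 3))‖ = 1 := by
    rw [← hPeq, norm_smul, norm_inv, norm_norm, hPn, inv_mul_cancel₀ hq0.ne']
  set Ph : EuclideanSpace ℝ (Fin 3) := ‖q‖⁻¹ • (‖c‖⁻¹ • (‖q‖ ^ 2 • ξ - inner ℝ q ξ • q)) with hPh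
  have hadd : ‖Ph + ξ‖ ^ 2 = 2 + 2 * (‖c‖ / ‖q‖) := by
    rw [norm_add_sq_real, hunit, hξ, hρ]; ring
  have hsub : ‖Ph - ξ‖ ^ 2 = 2 - 2 * (‖c‖ / ‖q‖) := by
    rw [norm_sub_sq_real, hunit, hξ, hρ]; ring
  have hprod : (‖Ph + ξ‖ * ‖Ph - ξ‖) ^ 2 ≤ (2 / ‖q‖) ^ 2 := by
    rw [mul_pow, hadd, hsub]
    have : (2 + 2 * (‖c‖ / ‖q‖)) * (2 - 2 * (‖c‖ / ‖q‖)) = 4 * inner ℝ q ξ ^ 2 / ‖q‖ ^ 2 := by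
      field_simp
      linear_combination (-4 : ℝ) * hc2
    rw [this, div_pow]
    rw [div_le_div_iff_of_pos_right (by positivity)]
    nlinarith
  exact (pow_le_pow_iff_left₀ (by positivity) (by positivity) two_ne_zero).1 hprod

/-! ### The carrier: frequencies of the packet -/

/-- On the cube, `‖latticeVec k‖ ≤ 2M`. [folklore] -/
theorem norm_latticeVec_le_of_mem_freqCube {M : ℕ} {k : Fin 3 → ℤ} (hk : k ∈ freqCube M) :
    ‖latticeVec k‖ ≤ 2 * M := by
  have h := norm_latticeVec_sq_le hk
  have h' : ‖latticeVec k‖ ^ 2 ≤ (2 * M) ^ 2 := h.trans (by nlinarith)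
  exact (pow_le_pow_iff_left₀ (norm_nonneg _) (by positivity) two_ne_zero).1 h'

/-- **Frequencies of the packet**: with `M + 1 = 2¹⁰ D`, `D ≥ 1` and a carrier of length
`2²² D - 1 ≤ |p| ≤ 2²² D + 1`, every frequency `k + p`, `k ∈ Ω_M`, lies in the shell
`2D < |m| ≤ 2²³ D`; some coordinate has `|2pᵢ| > 2M + D`; and `0 ∉ Ω_M + p`. [folklore] -/
theorem carrier_frequencies {D M : ℕ} (hD : 1 ≤ D) (hM : M + 1 = 2 ^ 10 * D) {p : Fin 3 → ℤ}
    (hlo : (2 : ℝ) ^ 22 * D - 1 ≤ ‖latticeVec p‖) (hhi : ‖latticeVec p‖ ≤ (2 : ℝ) ^ 22 * D + 1) :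
    (∀ k ∈ freqCube M, ((2 * D : ℕ) : ℝ) ^ 2 < freqNormSq (k + p) ∧
        freqNormSq (k + p) ≤ ((2 ^ 23 * D : ℕ) : ℝ) ^ 2) ∧
      (∃ i, ((2 * M + D : ℕ) : ℤ) < |2 * p i|) ∧ (0 : Fin 3 → ℤ) ∉ (freqCube M).image (· + p) := by
  have hDr : (1 : ℝ) ≤ D := by exact_mod_cast hD
  have hMr : (M : ℝ) + 1 = 2 ^ 10 * D := by exact_mod_cast hM
  have hM2 : 2 * (M : ℝ) ≤ 2 ^ 11 * D := by linarith
  refine ⟨fun k hk => ?_, ?_, ?_⟩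
  · have hkn := norm_latticeVec_le_of_mem_freqCube hk
    rw [freqNormSq_eq_norm_sq, latticeVec_add]
    have h1 : ‖latticeVec p‖ - ‖latticeVec k‖ ≤ ‖latticeVec k + latticeVec p‖ := by
      have := norm_sub_norm_le (latticeVec k + latticeVec p) (latticeVec k)
      rw [add_sub_cancel_left] at this
      linarith [abs_sub_abs_le_abs_sub ‖latticeVec p‖ ‖latticeVec k‖,
        norm_sub_norm_le (latticeVec p) (latticeVec k + latticeVec p),
        show ‖latticeVec p - (latticeVec k + latticeVec p)‖ = ‖latticeVec k‖ by
          rw [show latticeVec p - (latticeVec k + latticeVec p) = -latticeVec k by abel, norm_neg]]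
    have h2 : ‖latticeVec k + latticeVec p‖ ≤ ‖latticeVec k‖ + ‖latticeVec p‖ := norm_add_le _ _
    constructor
    · have hlow : (2 * D : ℝ) < ‖latticeVec k + latticeVec p‖ := by nlinarith
      have : ((2 * D : ℕ) : ℝ) = 2 * D := by push_cast; ring
      rw [this]
      exact pow_lt_pow_left₀ hlow (by positivity) two_ne_zero
    · have hup : ‖latticeVec k + latticeVec p‖ ≤ 2 ^ 23 * D := by nlinarith
      have : ((2 ^ 23 * D : ℕ) : ℝ) = 2 ^ 23 * D := by push_cast; ring
      rw [this]
      exact pow_le_pow_left₀ (norm_nonneg _) hup 2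
  · by_contra h
    push Not at h
    have hb : ∀ i, ((p i : ℝ)) ^ 2 ≤ (2 ^ 11 * D) ^ 2 := by
      intro i
      have hi := h i
      have hi' : |(2 * p i : ℝ)| ≤ 2 * M + D := by
        have : ((|2 * p i| : ℤ) : ℝ) ≤ ((2 * M + D : ℕ) : ℤ) := by exact_mod_cast hi
        push_cast at this
        exact this
      rw [abs_le] at hi'
      have hlo' : -(2 ^ 11 * (D : ℝ)) ≤ p i := by nlinarith
      have hhi' : (p i : ℝ) ≤ 2 ^ 11 * D := by nlinarith
      nlinarith
    have hn : ‖latticeVec p‖ ^ 2 ≤ 3 * (2 ^ 11 * D) ^ 2 := by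
      rw [EuclideanSpace.norm_sq_eq, Fin.sum_univ_three]
      simp only [latticeVec_apply, Real.norm_eq_abs, sq_abs]
      linarith [hb 0, hb 1, hb 2]
    nlinarith
  · intro h0
    obtain ⟨k, hk, hkp⟩ := Finset.mem_image.1 h0
    have hpk : p = -k := eq_neg_of_add_eq_zero_right hkp
    have : ‖latticeVec p‖ ≤ 2 * M := by
      rw [hpk, show latticeVec (-k) = -latticeVec k by
        ext i; simp [latticeVec_apply], norm_neg]
      exact norm_latticeVec_le_of_mem_freqCube hk
    nlinarith

end Summit.AnomalousDissipation.AnomalousDissipation.Theorems
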